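import Literature.NumberTheory.PAdicHodge.TateCocycleTransfer
import Literature.NumberTheory.GaloisRepresentations.IntegralGaloisAction
import Literature.NumberTheory.GaloisRepresentations.AbsGaloisGroup
import Mathlib.FieldTheory.KrullTopology
import Mathlib.FieldTheory.PrimitiveElement
import Mathlib.Topology.Separation.Hausdorff
import HarnessLib

/-!
# The degree-one transfer `Γ_F ≤ Gal(F̄/ℚ_p)` for twisted cocycles, II: continuity

Continuation of `TateCocycleTransfer`. There the corestriction cochain `twistedCor j c` of a cochain `c` on
`H = Γ_F = range toBase ≤ G₀ = Gal(F̄/K₀)` was shown to be a twisted `G₀`-cocycle and the reconstruction /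
transfer identities were proved, all as finite algebra. The `G₀`-level `H¹` theorems of the tree (Tate's
normalised traces, Tate–Sen) are statements about CONTINUOUS cocycles for the Krull topology; this file checks
that the transfer respects continuity and packages the transfer for continuous twisted cocycles on `Γ_F`:

* `TateDescent.isOpen_setOf_permEmb_eq` — the pieces `{g | gφ = ψ}` of `G₀` are open (open stabiliser of
  a primitive element of `F/K₀`, Mathlib `stabilizer_isOpen_of_isIntegral`);
* `TateDescent.continuous_twistedCor` — `cor_j(c)` is continuous on `G₀` as soon as `c` is continuous ON `H`
  (on the piece `{gφ = ψ}` it is `g ↦ u_j(s_ψ) · s_ψ • c(s_ψ⁻¹ g s_φ)`);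
* `BaseGaloisGroup.continuous_toBase`, `BaseGaloisGroup.isClosedEmbedding_toBase` — `Γ_F → G₀` is a closed embedding
  (continuous: a finite-dimensional `E₀/K₀` is fixed by every `σ` fixing the `F`-span of a `K₀`-basis;
  compact source, Hausdorff target);
* `TateDescent.liftToBase c` — a cochain `c` on `Γ_F` viewed on `H ⊆ G₀` (junk `0` off `H`),
  `liftToBase_toBase`, `continuousOn_liftToBase`;
* `TateDescent.exists_eq_twistedCoboundary_of_base` — **TRANSFER for continuous cocycles**: if every
  CONTINUOUS `χ^j`-twisted `1`-cocycle `C` on `G₀` is a twisted coboundary plus `ι(a)·ℓ` (`a ∈ K₀`, for a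
  fixed `ℓ : G₀ → ℂ_F` — e.g. `ℓ = 0`, or `ℓ = log χ` when `j = 0`), then every continuous `χ_F^j`-twisted
  `1`-cocycle `c` on `Γ_F` is `σ ↦ ι(χ_F(σ))^j · σ B − B + A · ℓ(σ)` with `B ∈ ℂ_F`, `A ∈ F`
  (Tate 1967 §3.3 Theorems 1–2 for `F` from the same statements over `ℚ_p`).

No named fact, no `sorry`, no instance; one definition with body (`liftToBase`).

## References

* J. Tate, *p-divisible groups* (1967), §3.3 Theorems 1–2. [Tate1967]
* J.-P. Serre, *Local Fields* (1979), Ch. VII §5 (restriction and corestriction). [SerreLocalFields1979]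
-/

noncomputable section

open ValuativeRel Field Finset Topology Filter

open scoped IntermediateField

namespace Literature.NumberTheory.PAdicHodge

open Literature.NumberTheory.GaloisRepresentations
open Literature.NumberTheory.GaloisRepresentations.IsNonarchimedeanLocalField

variable {F : Type} [Field F] [ValuativeRel F] [TopologicalSpace F] [IsNonarchimedeanLocalField F]
  [CharZero F] {p : ℕ} [Fact p.Prime] (hp : valuation F p < 1)

/-! ### `Γ_F → G₀` is a closed embedding -/

namespace BaseGaloisGroup

/-- **`toBase : Γ_F → G₀ = Gal(F̄/K₀)` is continuous** (Krull topologies): a finite-dimensional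
`E₀ ⊆ F̄` over `K₀` is fixed by every `σ ∈ Γ_F` fixing the (finite-dimensional) field generated over `F` by a
`K₀`-basis of `E₀`. [cite: SerreLocalFields1979, Ch. VII §5] -/
theorem continuous_toBase : Continuous (toBase hp) := by
  refine continuous_of_continuousAt_one (toBase hp) ?_
  rw [ContinuousAt, map_one, Filter.tendsto_def]
  intro s hs
  obtain ⟨E₀, hfin, hE₀⟩ :=
    (krullTopology_mem_nhds_one_iff (PadicBase F p hp) (NormedAlgClosure F) s).mp hs
  haveI := hfin
  -- the `F`-field generated by a `K₀`-basis of `E₀`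
  let b := Module.finBasis (PadicBase F p hp) E₀
  let S : Set (AlgebraicClosure F) :=
    Set.range fun i => NormedAlgClosure.toAlgClosure ((b i : E₀) : NormedAlgClosure F)
  let E : IntermediateField F (AlgebraicClosure F) := IntermediateField.adjoin F S
  haveI : FiniteDimensional F E :=
    IntermediateField.finiteDimensional_adjoin fun x _ => Algebra.IsIntegral.isIntegral x
  refine Filter.mem_of_superset (E.fixingSubgroup_isOpen.mem_nhds (one_mem _)) fun σ hσ => ?_
  refine hE₀ ((IntermediateField.mem_fixingSubgroup_iff _ _).mpr fun x hx => ?_)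
  -- `σ` fixes every basis vector, hence `x`
  have hb : ∀ i, toBase hp σ • ((b i : E₀) : NormedAlgClosure F) = (b i : E₀) := fun i => by
    rw [toBase_smul]
    exact (IntermediateField.mem_fixingSubgroup_iff _ _).mp hσ _
      (IntermediateField.subset_adjoin F S ⟨i, rfl⟩)
  have hx' : (⟨x, hx⟩ : E₀) = ∑ i, b.repr ⟨x, hx⟩ i • b i := (b.sum_repr ⟨x, hx⟩).symm
  have hxsum : x = ∑ i, b.repr ⟨x, hx⟩ i • ((b i : E₀) : NormedAlgClosure F) := by
    have := congrArg (fun z : E₀ => (z : NormedAlgClosure F)) hx'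
    simpa only [IntermediateField.coe_sum, IntermediateField.coe_smul] using this
  rw [hxsum]
  exact (map_sum (toBase hp σ) _ _).trans
    (Finset.sum_congr rfl fun i _ => by
      rw [Algebra.smul_def, map_mul, AlgEquiv.commutes]; exact congrArg _ (hb i))

/-- **`toBase : Γ_F → G₀` is a closed embedding** (continuous injection from a compact space to a Hausdorff
space). [cite: SerreLocalFields1979, Ch. VII §5] -/
theorem isClosedEmbedding_toBase : IsClosedEmbedding (toBase hp) :=
  (continuous_toBase hp).isClosedEmbedding (toBase_injective hp)

end BaseGaloisGroup

namespace TateDescent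

/-! ### The pieces `{g | gφ = ψ}` are open -/

/-- **The pieces `{g ∈ G₀ | gφ = ψ}` are open**: `gφ = ψ` iff `g` moves a primitive element `φ(θ)` of
`φ(F)/K₀` to `ψ(θ)`, and the stabiliser of `φ(θ)` is open. [cite: SerreLocalFields1979, Ch. VII §5] -/
theorem isOpen_setOf_permEmb_eq (φ ψ : Emb hp) : IsOpen {g : BaseGaloisGroup hp | permEmb hp g φ = ψ} := by
  let pb := Field.powerBasisOfFiniteOfSeparable (PadicBase F p hp) F
  have hset : {g : BaseGaloisGroup hp | permEmb hp g φ = ψ} =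
      {g : BaseGaloisGroup hp | g • φ pb.gen ∈ ({ψ pb.gen} : Set (NormedAlgClosure F))} := by
    ext g
    simp only [Set.mem_setOf_eq, Set.mem_singleton_iff]
    constructor
    · intro h; rw [← h]; rfl
    · intro h; exact pb.algHom_ext h
  rw [hset]
  exact isOpen_setOf_smul_mem_of_isOpen_stabilizer _
    (stabilizer_isOpen_of_isIntegral (K := PadicBase F p hp) (L := NormedAlgClosure F) _) _

/-- On the piece `{gφ = ψ}`: `h_φ(g) = s_ψ⁻¹ g s_φ`. [cite: SerreLocalFields1979, Ch. VII §5] -/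
theorem corr_eq_of_permEmb_eq {g : BaseGaloisGroup hp} {φ ψ : Emb hp} (h : permEmb hp g φ = ψ) :
    corr hp g φ = (liftEmb hp ψ)⁻¹ * g * liftEmb hp φ := by
  rw [corr, h]

/-! ### Continuity of the corestriction cochain -/

/-- **`cor_j(c)` is continuous on `G₀` when `c` is continuous on `H = range toBase`.** On the open piece
`{gφ = ψ}` the `φ`-summand is `g ↦ u_j(s_ψ) · s_ψ • c(s_ψ⁻¹ g s_φ)`, continuous because `g ↦ s_ψ⁻¹ g s_φ` is
continuous with values in `H`, `c` is continuous on `H`, and `s_ψ` acts continuously on `ℂ_F`.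
[cite: SerreLocalFields1979, Ch. VII §5] -/
theorem continuous_twistedCor (j : ℤ) {c : BaseGaloisGroup hp → CompletedAlgClosure F}
    (hc : ContinuousOn c (Set.range (BaseGaloisGroup.toBase hp))) : Continuous (twistedCor hp j c) := by
  have hsum : twistedCor hp j c = fun g => ∑ φ : Emb hp,
      TateTrace.ι hp (W hp (liftEmb hp (permEmb hp g φ))) ^ j * (liftEmb hp (permEmb hp g φ) • c (corr hp g φ)) :=
    rfl
  rw [hsum]
  refine continuous_finsetSum _ fun φ _ => continuous_iff_continuousAt.2 fun g₀ => ?_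
  set ψ := permEmb hp g₀ φ with hψ
  have hU : {g : BaseGaloisGroup hp | permEmb hp g φ = ψ} ∈ 𝓝 g₀ :=
    (isOpen_setOf_permEmb_eq hp φ ψ).mem_nhds rfl
  -- the conjugation `κ g = s_ψ⁻¹ g s_φ`, continuous, with values in `H` on the piece
  have hκ : Continuous fun g : BaseGaloisGroup hp => (liftEmb hp ψ)⁻¹ * g * liftEmb hp φ :=
    (continuous_const.mul continuous_id).mul continuous_const
  have hmaps : Set.MapsTo (fun g : BaseGaloisGroup hp => (liftEmb hp ψ)⁻¹ * g * liftEmb hp φ)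
      {g | permEmb hp g φ = ψ} (Set.range (BaseGaloisGroup.toBase hp)) := by
    intro g hg
    show (liftEmb hp ψ)⁻¹ * g * liftEmb hp φ ∈ Set.range (BaseGaloisGroup.toBase hp)
    rw [← corr_eq_of_permEmb_eq hp hg]
    exact exists_toBase_eq_corr hp g φ
  have hcκ : ContinuousAt (fun g : BaseGaloisGroup hp => c ((liftEmb hp ψ)⁻¹ * g * liftEmb hp φ)) g₀ :=
    (hc.comp hκ.continuousOn hmaps).continuousAt hU
  have hF : ContinuousAt (fun g : BaseGaloisGroup hp => TateTrace.ι hp (W hp (liftEmb hp ψ)) ^ j *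
      (liftEmb hp ψ • c ((liftEmb hp ψ)⁻¹ * g * liftEmb hp φ))) g₀ :=
    continuousAt_const.mul
      (((CompletedAlgClosure.continuous_base_smul hp (liftEmb hp ψ)).continuousAt).comp hcκ)
  refine hF.congr ?_
  filter_upwards [hU] with g hg
  have hg' : permEmb hp g φ = ψ := hg
  rw [corr_eq_of_permEmb_eq hp hg', hg']

/-! ### A cochain on `Γ_F` viewed on `H ⊆ G₀` -/

/-- **A cochain `c` on `Γ_F` viewed as a cochain on `G₀`**: `c ∘ toBase⁻¹` on `H = range toBase`, junk `0`
elsewhere (only the values on `H` are ever used). [cite: SerreLocalFields1979, Ch. VII §5] -/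
def liftToBase (c : absoluteGaloisGroup F → CompletedAlgClosure F) (g : BaseGaloisGroup hp) :
    CompletedAlgClosure F := by
  classical
  exact if h : ∃ σ : absoluteGaloisGroup F, BaseGaloisGroup.toBase hp σ = g then c h.choose else 0

/-- `liftToBase c (toBase σ) = c σ`. [cite: SerreLocalFields1979, Ch. VII §5] -/
theorem liftToBase_toBase (c : absoluteGaloisGroup F → CompletedAlgClosure F) (σ : absoluteGaloisGroup F) :
    liftToBase hp c (BaseGaloisGroup.toBase hp σ) = c σ := by
  classical
  have h : ∃ τ : absoluteGaloisGroup F, BaseGaloisGroup.toBase hp τ = BaseGaloisGroup.toBase hp σ := ⟨σ, rfl⟩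
  rw [liftToBase, dif_pos h]
  exact congrArg c (BaseGaloisGroup.toBase_injective hp h.choose_spec)

/-- **`liftToBase c` is continuous on `H` when `c` is continuous** (`toBase` is a closed embedding).
[cite: SerreLocalFields1979, Ch. VII §5] -/
theorem continuousOn_liftToBase {c : absoluteGaloisGroup F → CompletedAlgClosure F} (hc : Continuous c) :
    ContinuousOn (liftToBase hp c) (Set.range (BaseGaloisGroup.toBase hp)) := by
  rw [continuousOn_iff_continuous_restrict]
  have he := (BaseGaloisGroup.isClosedEmbedding_toBase hp).isEmbedding
  have heq : (Set.range (BaseGaloisGroup.toBase hp)).restrict (liftToBase hp c) = c ∘ he.toHomeomorph.symm := by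
    funext x
    obtain ⟨σ, rfl⟩ := he.toHomeomorph.surjective x
    rw [Function.comp_apply, Homeomorph.symm_apply_apply, Set.restrict_apply,
      Topology.IsEmbedding.toHomeomorph_apply_coe, liftToBase_toBase]
  rw [heq]
  exact hc.comp he.toHomeomorph.symm.continuous

/-- A twisted cocycle on `Γ_F` lifts to a twisted cocycle on `H ⊆ G₀` (multiplied by any `x ∈ F`, which `H`
fixes). [cite: SerreLocalFields1979, Ch. VII §5] -/
theorem liftToBase_mul_cocycle (j : ℤ) {c : absoluteGaloisGroup F → CompletedAlgClosure F}
    (hc : ∀ σ τ : absoluteGaloisGroup F,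
      c (σ * τ) = c σ + TateTrace.ι hp (W hp (BaseGaloisGroup.toBase hp σ)) ^ j * (σ • c τ)) (x : F)
    (h h' : BaseGaloisGroup hp) (hh : h ∈ Set.range (BaseGaloisGroup.toBase hp))
    (hh' : h' ∈ Set.range (BaseGaloisGroup.toBase hp)) :
    algebraMap F (CompletedAlgClosure F) x * liftToBase hp c (h * h') =
      algebraMap F (CompletedAlgClosure F) x * liftToBase hp c h +
        TateTrace.ι hp (W hp h) ^ j * (h • (algebraMap F (CompletedAlgClosure F) x * liftToBase hp c h')) := by
  obtain ⟨σ, rfl⟩ := hh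
  obtain ⟨τ, rfl⟩ := hh'
  rw [← map_mul, liftToBase_toBase, liftToBase_toBase, liftToBase_toBase, hc σ τ, smul_mul',
    CompletedAlgClosure.toBase_smul_algebraMap_completion, CompletedAlgClosure.toBase_smul_completion]
  ring

/-! ### The transfer for continuous cocycles -/

/-- **TRANSFER `G₀ ⇝ Γ_F` for CONTINUOUS twisted cocycles** (Tate 1967 §3.3 for `F` from the statement over
`ℚ_p`). Fix `j ∈ ℤ` and `ℓ : G₀ → ℂ_F`. Suppose every continuous `χ^j`-twisted `1`-cocycle `C` on
`G₀ = Gal(F̄/K₀)` is of the form `C(g) = ι(χ(g))^j · g b − b + ι(a) · ℓ(g)` (`b ∈ ℂ_F`, `a ∈ K₀`). Then every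
continuous `χ_F^j`-twisted `1`-cocycle `c` on `Γ_F` is of the form
`c(σ) = ι(χ_F(σ))^j · σ B − B + A · ℓ(toBase σ)` with `B ∈ ℂ_F`, `A ∈ F`. (With `ℓ = 0`:
`H¹_cont(Γ_F, ℂ_F(χ^j)) = 0` from `H¹_cont(G₀, ℂ_F(χ^j)) = 0`; with `j = 0`, `ℓ = log χ`:
`H¹_cont(Γ_F, ℂ_F) = F·[log χ_F]` from `H¹_cont(G₀, ℂ_F) = ℚ_p·[log χ]`.) Proof: apply the hypothesis to the
continuous cocycles `cor_j(eᵢ · c)` for a `K₀`-basis `(eᵢ)` of `F` and use the algebraic transfer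
`exists_eq_twistedCoboundary_of_forall_twistedCor`. [cite: Tate1967, §3.3 Theorems 1–2] [cite: SerreLocalFields1979, Ch. VII §5] -/
theorem exists_eq_twistedCoboundary_of_base (j : ℤ) (ℓ : BaseGaloisGroup hp → CompletedAlgClosure F)
    (hG : ∀ C : BaseGaloisGroup hp → CompletedAlgClosure F,
      (∀ g g' : BaseGaloisGroup hp, C (g * g') = C g + TateTrace.ι hp (W hp g) ^ j * (g • C g')) →
      Continuous C →
        ∃ (b : CompletedAlgClosure F) (a : PadicBase F p hp), ∀ g : BaseGaloisGroup hp,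
          C g = TateTrace.ι hp (W hp g) ^ j * (g • b) - b + TateTrace.ι hp a * ℓ g)
    {c : absoluteGaloisGroup F → CompletedAlgClosure F}
    (hc : ∀ σ τ : absoluteGaloisGroup F,
      c (σ * τ) = c σ + TateTrace.ι hp (W hp (BaseGaloisGroup.toBase hp σ)) ^ j * (σ • c τ))
    (hcont : Continuous c) :
    ∃ (B : CompletedAlgClosure F) (A : F), ∀ σ : absoluteGaloisGroup F,
      c σ = TateTrace.ι hp (W hp (BaseGaloisGroup.toBase hp σ)) ^ j * (σ • B) - B +
        algebraMap F (CompletedAlgClosure F) A * ℓ (BaseGaloisGroup.toBase hp σ) := by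
  classical
  set c' := liftToBase hp c with hc'
  let e := Module.finBasis (PadicBase F p hp) F
  -- the `H`-cocycles `eᵢ · c'` and their (continuous) corestrictions
  have hci : ∀ i : Fin (Module.finrank (PadicBase F p hp) F), ∀ h h' : BaseGaloisGroup hp,
      h ∈ Set.range (BaseGaloisGroup.toBase hp) → h' ∈ Set.range (BaseGaloisGroup.toBase hp) →
        algebraMap F (CompletedAlgClosure F) (e i) * c' (h * h') =
          algebraMap F (CompletedAlgClosure F) (e i) * c' h +
            TateTrace.ι hp (W hp h) ^ j * (h • (algebraMap F (CompletedAlgClosure F) (e i) * c' h')) :=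
    fun i h h' hh hh' => liftToBase_mul_cocycle hp j hc (e i) h h' hh hh'
  have hsol : ∀ i : Fin (Module.finrank (PadicBase F p hp) F), ∃ (b : CompletedAlgClosure F) (a : PadicBase F p hp),
      ∀ g : BaseGaloisGroup hp, twistedCor hp j (fun g' => algebraMap F (CompletedAlgClosure F) (e i) * c' g') g =
        TateTrace.ι hp (W hp g) ^ j * (g • b) - b + TateTrace.ι hp a * ℓ g := by
    intro i
    refine hG _ (twistedCor_mul hp j (hci i)) (continuous_twistedCor hp j ?_)
    exact (continuousOn_const.mul (continuousOn_liftToBase hp hcont))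
  choose b a hba using hsol
  -- `c'` itself is an `H`-cocycle (the case `x = 1`)
  have hc'coc : ∀ h h' : BaseGaloisGroup hp, h ∈ Set.range (BaseGaloisGroup.toBase hp) →
      h' ∈ Set.range (BaseGaloisGroup.toBase hp) →
        c' (h * h') = c' h + TateTrace.ι hp (W hp h) ^ j * (h • c' h') := by
    intro h h' hh hh'
    have := liftToBase_mul_cocycle hp j hc 1 h h' hh hh'
    simpa only [map_one, one_mul] using this
  obtain ⟨B, A, hBA⟩ := exists_eq_twistedCoboundary_of_forall_twistedCor hp hc'coc e ℓ a b hba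
  refine ⟨B, A, fun σ => ?_⟩
  have h1 := hBA (BaseGaloisGroup.toBase hp σ) ⟨σ, rfl⟩
  rw [hc', liftToBase_toBase, CompletedAlgClosure.toBase_smul_completion] at h1
  exact h1

end TateDescent

end Literature.NumberTheory.PAdicHodge

end
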